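import Literature.AnabelianGeometry.EtaleTheta.SettingModelTateOrigin
import Literature.AnabelianGeometry.EtaleTheta.SettingModelTateThetaCusp
import Literature.AnabelianGeometry.EtaleTheta.SettingModelTateThetaTopology
import Literature.AnabelianGeometry.EtaleTheta.SettingModelChiTwistedSections
import HarnessLib

/-!
# The ORIGIN PROFILE of the CUSPED stage-2 model `ThetaSetting.modelχq′ p i 2 even_two`:
# `IsTateOrigin` ✓, R1 ✓, cusp ✓, R3 ✓, `GKNIsKernelOfAction` ✓ — and R2 (`GtpYNFromCusp`) ✗ for every `N ≥ 2`

abc-iut cell, layer L2, R78 cluster STAGE 2 (integrator abc-iut-L6-d6), seat abc-iut-w5-d051 (gen 3; origin-profile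
lineage: `SettingModelChiOriginProfile` (stage 1), `SettingModelTateOrigin` §4 (stage 2, cusp-free carrier)); named for
this file by abc-iut-w5-d029 (F5qc, `SettingModelTateThetaCusp`). Mochizuki, *The étale theta function …*, Publ. RIMS
**45** (2009) [EtTh], §1 pp. 12–13 [cite: MochizukiEtTh2009, §1 p.13]: «any decomposition group of a cusp of `Y^log`
determines, up to conjugation by `(Δ^tp_Y)^ell`, a section `G_K → (Π^tp_Y)^ell` […] whose restriction to the open
subgroup `G_{K_N} ⊆ G_K` determines an open immersion `G_{K_N} ↪ (Π^tp_Y)^ell/N·(Δ^tp_Y)^ell` […] this image determines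
a Galois covering `Y_N → Y`» (R2, abc-iut-L6-d5's `Thm16Sub.GtpYNFromCusp`); [SemiAnbd] §6 p. 71 «`I_x ≅ Ẑ(1)`»
[cite: MochizukiSemiAnbd2006, §6 p.71].

abc-iut-w5-d029's cusped record `ThetaSetting.modelχq′ p i j hj` has the SAME `Π^tp_X = Γ ⋊ G_{ℚ_p}`, `toZ`, `aug`,
theta layer and `Π^tp_{Y_N}` as abc-iut-L2-t5's `ThetaSetting.modelχq p i j hj` (`modelχq'_PiTemp`, `modelχq'_toZ`,
`modelχq'_GtpYN_GtpZN`, `thetaKer_curveχq'_eq`, all `rfl`) plus ONE synthetic cusp with decomposition group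
`b^Ẑ ⋊ G_{ℚ_p}` (`cuspDecompχq`). Hence (§1) every clause of `ThetaSettingOriginClauses` / `Thm16SubdagStatements` that
does not read the cusp TRANSPORTS VERBATIM from `SettingModelTateOrigin` / `SettingModelTateThetaTopology`:
`modelχq'_isTateOrigin` (the print-faithful Tate-module clause, ALL of (a)(a′)(b)(c), EVERY `N`),
`modelχq'_gknIsKernelOfAction`, `kerToZIsCompactlyGenerated_modelχq'` (R1), `isQuotientMap_toTheta_modelχq'` /
`isQuotientMap_thetaToEll_modelχq'` (R3), `modelχq'_tate2` (TM₂); (§2) the cusp clause of `IsThm16Origin` HOLDS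
(`exists_cuspidal_le_GtpY_modelχq'`: `b^Ẑ ⋊ G_{ℚ_p}` is cuspidal and lies in `Π^tp_Y`); (§3) **R2 FAILS for every
`N ≥ 2`** (`not_gtpYNFromCusp_modelχq'`): the witness is the generator `y₁ = inl b` of `Δ^tp_Y` itself — it lies ON the
toral cusp axis with `aug y₁ = 1 ∈ G_{K_N}`, so the printed right-hand side («image in `(Π^tp_Y)^ell` inside the
cusp-section image times `N·(Δ^tp_Y)^ell`») holds, while `y₁ ∉ Π^tp_{Y_N}` because `1 ≢ 0 (N)`
(`bPowGfp_mem_dY_iff`). In print the inertia of the cusp is the COMMUTATOR axis, which dies in `(Δ^tp_Y)^ell`; at the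
toral cusp it maps ONTO `(Δ^tp_Y)^ell` (abc-iut-L2-t10's `not_inertiaClause_curveχq'`, the §2-side twin of this failure).
(§4) `not_isThm16Origin_modelχq'` — by R2 ALONE — and the summary `modelχq'_origin_profile`; `stageTwo_origin_fields`
records the NET census over the two stage-2 models: EVERY field of `IsThm16Origin` is inhabited at one of them; the
conjunction fails at `modelχq` by the cusp-existence field only (`SettingModelTateOrigin.not_isThm16Origin_modelχq`) and
at `modelχq′` by R2 only — the residual is exactly the cusp AXIS (`SettingModelCuspAxis`).

PROOF-ONLY (no definition, no named fact, zero edit of any other seat's file). Semi-synthetic models = consistency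
evidence only; nothing of [EtTh]/[SemiAnbd] is asserted for genuine tempered fundamental groups; no side is taken on
[IUTchIII] Cor. 3.12; typed ≠ proved.
-/

noncomputable section

namespace Literature.AnabelianGeometry.EtaleTheta.SettingModel

open Literature.AnabelianGeometry.SemiGraphs Thm16Sub Function Topology

section Model

variable (p : ℕ) [Fact p.Prime] (i : ℤ)

/-! ### 1. The clauses that do not read the cusp transport verbatim from `modelχq` -/

/-- **`IsTateOrigin` HOLDS at the cusped stage-2 model** (all of (a)(a′)(b)(c), every `N`): the clause reads only
`Π^tp_X`, `Δ^tp_Y`, `toZ`, `aug`, `q_X` and the ell-quotient, all shared with `modelχq` — transport of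
`modelχq_isTateOrigin`. [cite: MochizukiEtTh2009, §1 p.13] -/
theorem modelχq'_isTateOrigin : (ThetaSetting.modelχq' p i 2 even_two).IsTateOrigin :=
  ⟨(modelχq_isTateOrigin p i).tate⟩

/-- **`G_{K_N}` is the kernel of the action mod `N`** at the cusped stage-2 model, every `N`.
[cite: MochizukiEtTh2009, §1 p.13] -/
theorem modelχq'_gknIsKernelOfAction (N : ℕ+) : GKNIsKernelOfAction (ThetaSetting.modelχq' p i 2 even_two) N :=
  modelχq_gknIsKernelOfAction p i N

/-- **R1 HOLDS at the cusped stage-2 model** (`Π^tp_Y` is topologically generated by compact subgroups).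
[cite: MochizukiEtTh2009, §1 p.12] -/
theorem kerToZIsCompactlyGenerated_modelχq' : KerToZIsCompactlyGenerated (ThetaSetting.modelχq' p i 2 even_two) :=
  kerToZIsCompactlyGenerated_modelχq p i

/-- **R3 (first quotient) HOLDS at the cusped stage-2 model** (abc-iut-L2-t8's `isQuotientMap_toTheta_modelχq`
transported). [cite: MochizukiEtTh2009, §1 p.12] -/
theorem isQuotientMap_toTheta_modelχq' : _root_.Topology.IsQuotientMap (ThetaSetting.modelχq' p i 2 even_two).toTheta :=
  isQuotientMap_toTheta_modelχq p i 2 even_two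

/-- **R3 (second quotient) HOLDS at the cusped stage-2 model.** [cite: MochizukiEtTh2009, §1 p.12] -/
theorem isQuotientMap_thetaToEll_modelχq' : _root_.Topology.IsQuotientMap (ThetaSetting.modelχq' p i 2 even_two).thetaToEll :=
  isQuotientMap_thetaToEll_modelχq p i 2 even_two

/-- **TM₂ (`IsThm16Origin.tate2`) HOLDS at the cusped stage-2 model.** [cite: MochizukiEtTh2009, §1 p.13] -/
theorem modelχq'_tate2 :
    ∃ (y₁ z : (ThetaSetting.modelχq' p i 2 even_two).PiTemp) (ζ r : PadicAlgCl p),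
      y₁ ∈ (ThetaSetting.modelχq' p i 2 even_two).DtpY ∧ z ∈ (ThetaSetting.modelχq' p i 2 even_two).DeltaTemp ∧
      (ThetaSetting.modelχq' p i 2 even_two).toZ z = Multiplicative.ofAdd 1 ∧
      IsPrimitiveRoot ζ ((2 : ℕ+) : ℕ) ∧ r ^ ((2 : ℕ+) : ℕ) = (ThetaSetting.modelχq' p i 2 even_two).qX ∧
      (∀ y : (ThetaSetting.modelχq' p i 2 even_two).PiTemp, y ∈ (ThetaSetting.modelχq' p i 2 even_two).DtpY → ∃ k : ℕ,
        toEll (ThetaSetting.modelχq' p i 2 even_two) y * (toEll (ThetaSetting.modelχq' p i 2 even_two) y₁ ^ k)⁻¹ ∈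
          ellPowersY (ThetaSetting.modelχq' p i 2 even_two) 2) ∧
      (∀ k : ℕ, toEll (ThetaSetting.modelχq' p i 2 even_two) y₁ ^ k ∈
          ellPowersY (ThetaSetting.modelχq' p i 2 even_two) 2 ↔ ((2 : ℕ+) : ℕ) ∣ k) ∧
      (∀ (g : (ThetaSetting.modelχq' p i 2 even_two).PiTemp) (k : ℕ),
        (ThetaSetting.modelχq' p i 2 even_two).aug g ζ = ζ ^ k →
        ∀ y : (ThetaSetting.modelχq' p i 2 even_two).PiTemp, y ∈ (ThetaSetting.modelχq' p i 2 even_two).DtpY →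
          toEll (ThetaSetting.modelχq' p i 2 even_two) (g * y * g⁻¹) *
              (toEll (ThetaSetting.modelχq' p i 2 even_two) y ^ k)⁻¹ ∈
            ellPowersY (ThetaSetting.modelχq' p i 2 even_two) 2) ∧
      (∀ (g : (ThetaSetting.modelχq' p i 2 even_two).PiTemp) (m : ℕ),
        (ThetaSetting.modelχq' p i 2 even_two).aug g r = ζ ^ m * r →
        toEll (ThetaSetting.modelχq' p i 2 even_two) (g * z * g⁻¹ * z⁻¹) *
            (toEll (ThetaSetting.modelχq' p i 2 even_two) y₁ ^ m)⁻¹ ∈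
          ellPowersY (ThetaSetting.modelχq' p i 2 even_two) 2) :=
  (modelχq'_isTateOrigin p i).tate2

/-! ### 2. The cusp clause of `IsThm16Origin` HOLDS -/

/-- **`X^log` has a cusp whose decomposition group lies in `Π^tp_Y`** at the cusped stage-2 model: `b^Ẑ ⋊ G_{ℚ_p}`.
[cite: MochizukiEtTh2009, §1 p.12] -/
theorem exists_cuspidal_le_GtpY_modelχq' :
    ∃ Dc : Subgroup (PiTpχq p i 2), (ThetaSetting.modelχq' p i 2 even_two).IsCuspidalDecompositionGroup Dc ∧
      Dc ≤ (ThetaSetting.modelχq' p i 2 even_two).GtpY :=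
  ⟨cuspDecompχq p i 2, isCuspidalDecompositionGroup_cuspDecompχq p i 2, decomp_modelχq'_le_GtpY p i 2 even_two ()⟩

/-! ### 3. R2 FAILS for every `N ≥ 2`: the generator of `Δ^tp_Y` lies on the toral cusp axis -/

/-- `y₁ = inl b` lies in the cusp's decomposition group `b^Ẑ ⋊ G_{ℚ_p}`. [cite: MochizukiEtTh2009, §1 p.13] -/
theorem inl_bPowGfp_mem_cuspDecompχq (t : ZH) :
    (SemidirectProduct.inl (bPowGfp t) : PiTpχq p i 2) ∈ cuspDecompχq p i 2 :=
  (mem_cuspDecompχq_iff p i 2 _).mpr (by rw [SemidirectProduct.left_inl]; exact bPowGfp_mem_bAxisGfp t)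

/-- `y₁ = inl b ∉ Π^tp_{Y_N}` for `N ≥ 2` (`ĥ_y(b) = 1 ≢ 0 (N)`). [cite: MochizukiEtTh2009, §1 p.13] -/
theorem inl_bPowGfp_one_not_mem_GtpYN (N : ℕ+) (hN : 2 ≤ (N : ℕ)) :
    (SemidirectProduct.inl (bPowGfp (iotaZ (Multiplicative.ofAdd 1))) : PiTpχq p i 2) ∉
      (ThetaSetting.modelχq' p i 2 even_two).GtpYN N := by
  intro h
  have h1 := ((tateTwistData₀ p i 2).mem_YN.mp h).1
  rw [SemidirectProduct.left_inl, bPowGfp_mem_dY_iff, iotaZ_one_eq, ZHatLevel.level_eta, Int.cast_one] at h1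
  have h2 : (1 : ZMod N) = 0 := Multiplicative.ofAdd.injective h1
  haveI : Fact (1 < (N : ℕ)) := ⟨hN⟩
  exact one_ne_zero h2

/-- **R2 (`GtpYNFromCusp`) FAILS at the cusped stage-2 model for every `N ≥ 2`.** Against the cuspidal decomposition
group `b^Ẑ ⋊ G_{ℚ_p} ≤ Π^tp_Y`, the element `y₁ = inl b` satisfies the printed right-hand side (`y₁ ∈ Π^tp_Y`,
`aug y₁ = 1 ∈ G_{K_N}`, and `y₁` itself lies in the cusp group) but not the left (`y₁ ∉ Π^tp_{Y_N}`).
[cite: MochizukiEtTh2009, §1 p.13] -/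
theorem not_gtpYNFromCusp_modelχq' (N : ℕ+) (hN : 2 ≤ (N : ℕ)) :
    ¬ GtpYNFromCusp (ThetaSetting.modelχq' p i 2 even_two) N := by
  intro h
  have hyY : (SemidirectProduct.inl (bPowGfp (iotaZ (Multiplicative.ofAdd 1))) : PiTpχq p i 2) ∈
      (ThetaSetting.modelχq' p i 2 even_two).GtpY :=
    (Subgroup.mem_inf.mp (inl_bPowGfp_mem_dtpYq p i (iotaZ (Multiplicative.ofAdd 1)))).1
  have haug : (ThetaSetting.modelχq' p i 2 even_two).aug
      (SemidirectProduct.inl (bPowGfp (iotaZ (Multiplicative.ofAdd 1))) : PiTpχq p i 2) = 1 := rfl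
  have hGKN : (ThetaSetting.modelχq' p i 2 even_two).aug
      (SemidirectProduct.inl (bPowGfp (iotaZ (Multiplicative.ofAdd 1))) : PiTpχq p i 2) ∈
        (ThetaSetting.modelχq' p i 2 even_two).GKN N := by
    rw [haug]; exact one_mem _
  have hell : toEll (ThetaSetting.modelχq' p i 2 even_two)
        (SemidirectProduct.inl (bPowGfp (iotaZ (Multiplicative.ofAdd 1))) : PiTpχq p i 2) ∈
      (cuspDecompχq p i 2 ⊓ ((ThetaSetting.modelχq' p i 2 even_two).GKN N).comap
          (ThetaSetting.modelχq' p i 2 even_two).aug.toMonoidHom).map (toEll (ThetaSetting.modelχq' p i 2 even_two)) ⊔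
        ellPowersY (ThetaSetting.modelχq' p i 2 even_two) N :=
    Subgroup.mem_sup_left (Subgroup.mem_map_of_mem _
      (Subgroup.mem_inf.mpr ⟨inl_bPowGfp_mem_cuspDecompχq p i _, Subgroup.mem_comap.mpr hGKN⟩))
  exact inl_bPowGfp_one_not_mem_GtpYN p i N hN
    ((h (cuspDecompχq p i 2) (isCuspidalDecompositionGroup_cuspDecompχq p i 2)
      (decomp_modelχq'_le_GtpY p i 2 even_two ()) _).mpr ⟨hyY, hGKN, hell⟩)

/-! ### 4. The profile -/

/-- **`IsThm16Origin` FAILS at the cusped stage-2 model — by R2 alone.** [cite: MochizukiEtTh2009, §1 p.13] -/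
theorem not_isThm16Origin_modelχq' : ¬ (ThetaSetting.modelχq' p i 2 even_two).IsThm16Origin :=
  fun h => not_gtpYNFromCusp_modelχq' p i 2 le_rfl (h.gtpYN_fromCusp 2)

/-- **The origin profile of the cusped stage-2 model**: guard ✓, R1 ✓, cusp ✓, R3 ✓ ✓, TM (every `N`) ✓,
`GKNIsKernelOfAction` (every `N`) ✓, R2 ✗ (every `N ≥ 2`) — hence `IsThm16Origin` ✗ by R2 alone.
[cite: MochizukiEtTh2009, §1 p.12] -/
theorem modelχq'_origin_profile :
    (ThetaSetting.modelχq' p i 2 even_two).IsEtThOrigin ∧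
      KerToZIsCompactlyGenerated (ThetaSetting.modelχq' p i 2 even_two) ∧
      (∃ Dc : Subgroup (PiTpχq p i 2), (ThetaSetting.modelχq' p i 2 even_two).IsCuspidalDecompositionGroup Dc ∧
        Dc ≤ (ThetaSetting.modelχq' p i 2 even_two).GtpY) ∧
      _root_.Topology.IsQuotientMap (ThetaSetting.modelχq' p i 2 even_two).toTheta ∧
      _root_.Topology.IsQuotientMap (ThetaSetting.modelχq' p i 2 even_two).thetaToEll ∧
      (ThetaSetting.modelχq' p i 2 even_two).IsTateOrigin ∧
      (∀ N : ℕ+, GKNIsKernelOfAction (ThetaSetting.modelχq' p i 2 even_two) N) ∧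
      (∀ N : ℕ+, 2 ≤ (N : ℕ) → ¬ GtpYNFromCusp (ThetaSetting.modelχq' p i 2 even_two) N) ∧
      ¬ (ThetaSetting.modelχq' p i 2 even_two).IsThm16Origin :=
  ⟨ThetaSetting.modelχq'_isEtThOrigin p i 2 even_two, kerToZIsCompactlyGenerated_modelχq' p i,
    exists_cuspidal_le_GtpY_modelχq' p i, isQuotientMap_toTheta_modelχq' p i, isQuotientMap_thetaToEll_modelχq' p i,
    modelχq'_isTateOrigin p i, modelχq'_gknIsKernelOfAction p i, not_gtpYNFromCusp_modelχq' p i,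
    not_isThm16Origin_modelχq' p i⟩

/-- **NET CENSUS over the two stage-2 models.** Every field of `IsThm16Origin` is inhabited at `modelχq` or at
`modelχq′`: R1, R3 (both quotients) and TM₂ at BOTH; R2 at `modelχq` (vacuously — no cusp); the cusp-existence field at
`modelχq′`. The conjunction fails at `modelχq` by the cusp field only and at `modelχq′` by R2 only.
[cite: MochizukiEtTh2009, §1 p.12] -/
theorem stageTwo_origin_fields :
    (KerToZIsCompactlyGenerated (ThetaSetting.modelχq p i 2 even_two) ∧
        KerToZIsCompactlyGenerated (ThetaSetting.modelχq' p i 2 even_two)) ∧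
      ((∀ N : ℕ+, GtpYNFromCusp (ThetaSetting.modelχq p i 2 even_two) N) ∧
        ¬ GtpYNFromCusp (ThetaSetting.modelχq' p i 2 even_two) 2) ∧
      ((¬ ∃ Dc : Subgroup (PiTpχq p i 2), (ThetaSetting.modelχq p i 2 even_two).IsCuspidalDecompositionGroup Dc ∧
          Dc ≤ (ThetaSetting.modelχq p i 2 even_two).GtpY) ∧
        (∃ Dc : Subgroup (PiTpχq p i 2), (ThetaSetting.modelχq' p i 2 even_two).IsCuspidalDecompositionGroup Dc ∧
          Dc ≤ (ThetaSetting.modelχq' p i 2 even_two).GtpY)) ∧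
      ((_root_.Topology.IsQuotientMap (ThetaSetting.modelχq p i 2 even_two).toTheta ∧
          _root_.Topology.IsQuotientMap (ThetaSetting.modelχq p i 2 even_two).thetaToEll) ∧
        (_root_.Topology.IsQuotientMap (ThetaSetting.modelχq' p i 2 even_two).toTheta ∧
          _root_.Topology.IsQuotientMap (ThetaSetting.modelχq' p i 2 even_two).thetaToEll)) ∧
      ((ThetaSetting.modelχq p i 2 even_two).IsTateOrigin ∧ (ThetaSetting.modelχq' p i 2 even_two).IsTateOrigin) ∧
      (¬ (ThetaSetting.modelχq p i 2 even_two).IsThm16Origin ∧ ¬ (ThetaSetting.modelχq' p i 2 even_two).IsThm16Origin) :=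
  ⟨⟨kerToZIsCompactlyGenerated_modelχq p i, kerToZIsCompactlyGenerated_modelχq' p i⟩,
    ⟨modelχq_gtpYNFromCusp p i, not_gtpYNFromCusp_modelχq' p i 2 le_rfl⟩,
    ⟨fun ⟨Dc, hDc, _⟩ => not_isCuspidalDecompositionGroup_modelχq p i Dc hDc, exists_cuspidal_le_GtpY_modelχq' p i⟩,
    ⟨⟨isQuotientMap_toTheta_modelχq p i 2 even_two, isQuotientMap_thetaToEll_modelχq p i 2 even_two⟩,
      ⟨isQuotientMap_toTheta_modelχq' p i, isQuotientMap_thetaToEll_modelχq' p i⟩⟩,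
    ⟨modelχq_isTateOrigin p i, modelχq'_isTateOrigin p i⟩,
    ⟨not_isThm16Origin_modelχq p i, not_isThm16Origin_modelχq' p i⟩⟩

end Model

end Literature.AnabelianGeometry.EtaleTheta.SettingModel

end
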